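import Mathlib
import Literature.NumberTheory.LFunctions.Zhang2022.Section11GCShortInterval
import Literature.NumberTheory.LFunctions.Zhang2022.Section11LamCSums
import Literature.NumberTheory.LFunctions.Zhang2022.SkeletonPartTwo
import HarnessLib

/-!
# Zhang (2022) §11 p. 64 («by (11.3), (8.25) and (8.26)»): the bound for `S_j(𝐚₁,𝐚₂)` at window-supported sequences

Topic `Literature/NumberTheory/LFunctions/Zhang2022` (Landau–Siegel audit tree; verdict-neutral).
Y. Zhang, *Discrete mean estimates and the Landau–Siegel zero*, arXiv:2211.02515v1 (2022)
[Zhang2022LandauSiegel] — **an unrefereed manuscript under adjudication; nothing here asserts or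
denies its Theorems 1–2.** §11 p. 64 (tex L3298–3301) bounds the window mean square
`ΣΣ𝔠*|Σ_{n∈𝔍₁}χψ(n)n^{−ρ}(f̃ − g̃₁)(n)|²ω = o(𝔞𝔓)` «by (11.3), (8.25) and (8.26)»; the displays
(8.25)/(8.26) do not exist in v1 (GAP row G-L3t10-1; leaves `Typed.TypedSection11B.Step11u019`,
`Step11u019J2` of `Skeleton.theorem1_of_leaves_v19`). Read through the manuscript's own Lemma 8.1
and Proposition 7.1 (tree: `Section11WindowMeanSquare.step11u019_of_sjWindow`, which reduces the
leaf to «`𝓛⁹·S_j(𝐚, 𝐚̄) → 0`» for the window sequence `𝐚 = χ·1_{𝔍₁}·(f̃ − g̃₁)`), what remains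
is an ARITHMETIC bound for the sums `S_j(𝐚₁,𝐚₂)` of Prop. 7.1 at sequences supported on short
multiplicative windows `(xη₋, xη₊)`, `η± = e^{±𝓛⁻¹⁰}`. THIS FILE PROVES IT by absolute values
(`norm_Sj_window_le`):

  `‖S_j(𝐚₁,𝐚₂)‖ ≤ C·k²·B₁B₂·𝓛⁸` for `‖𝐚ᵢ‖ ≤ Bᵢ` supported on `k` windows with centres `x ≤ P`,
  `D ≥ D₀(c′)`, `C` absolute.

With `Bᵢ = C_L𝓛⁻¹⁰` ((11.3)) this is `O(𝓛⁻¹²)`, against the `𝓛⁻⁹` that the main term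
`α⁻¹(½S₁+2S₂+3/2S₃)𝔓` of Prop. 7.1 tolerates. Route (the cell's routing note D-G-L3t10-1 «no
absolute majorant suffices» was computed for coefficients of size `≍ 1`):

* `|λ₀ⱼ(dr)| ≤ Λc(d)Λc(r)`, `|ξ₀ⱼ(n;d,r)| ≤ gC(n)` (tree, `Section7SjPolylog`), with the prime bound
  `gC(p) ≤ 3 + 7B log p + (36+7M₀)/p` of log-mean EXPONENT 3 (`gC_prime_le_sharp`, from
  `‖κ(p)‖ ≤ 2 + B log p`; `B = |b₁|+|b₂|+|b₃| ≤ 9π𝓛⁻⁹`);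
* the `m`-window: `Σ_{X<m<θX} 1/m ≤ (θ−1) + 1/X` (`sum_inv_window_le`), `θ = η₊/η₋ = e^{2𝓛⁻¹⁰}`;
* the `n`-window: `Σ_{X<n<θX} gC(n)/n ≤ C_G𝓛⁸` for `X ≤ P` (`window_gC_div_le`): Shiu's theorem
  for `gC` in the tree's packaging `XiZeroMajorant.gC_window_div_le` (`Section11GCShortInterval`,
  helper H1) when `X ≥ 𝓛¹⁴`, the Euler-product majorant `sum_div_le_gen` below;
* the weights: `Σ_{d<N}Λc(d)/d ≤ C log N` (`sum_LamC_div_le`), `Σ_r μ²(r)Λc(r)/(rφ(r)) = O(1)` and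
  `Σ_{d≤W}Λc(d) ≤ CW` (`Section11LamCSums`, helper H2) — the last one counts the pairs `(d,r)` with
  `dr` within `𝓛¹⁰` of a window edge, where the `m`-window degenerates to `O(1)` terms.

Budget: `k·C_G𝓛⁸·[k(θ−1)·C𝓛⁹·C + k·Cθ] = O(k²𝓛⁸)`. 0 definitions; standard axioms.

## References

* Y. Zhang, arXiv:2211.02515v1 (2022), §7 Prop. 7.1 p. 33; §11 p. 64.
  [cite: Zhang2022LandauSiegel, §7 Prop. 7.1 p.33; §11 p.64]
* P. Shiu, J. reine angew. Math. 313 (1980), 161–170, Theorem 1. [cite: Shiu1980, Theorem 1]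
* R. R. Hall, G. Tenenbaum, *Divisors* (CUP 1988), (0.4). [cite: HallTenenbaum1988, (0.4)]
-/

noncomputable section

open Finset Real ArithmeticFunction

namespace Literature.NumberTheory.LFunctions.Zhang2022.WindowSj

open MeanSquareMajorant XiZeroMajorant Skeleton

variable (c' : ℝ) (D : ℕ)

/-! ### Part 1. The majorant `gC` at primes with `log p` accuracy -/

/-- **`gC(p) ≤ 3 + 7B log p + (36 + 7M₀)/p`** at every prime, `B = |b₁|+|b₂|+|b₃|`
(`Kmaj p ≤ ‖κ(p)‖ + 8S₃/p ≤ 2 + B log p + 8S₃/p`, `w(p) = p/(p−1) ≤ 1 + 2/p`, `Λc(p) = 1 + 12/p`).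
[cite: Zhang2022LandauSiegel, §7 p.33] -/
theorem gC_prime_le_sharp {p : ℕ} (hp : p.Prime) :
    gC c' D p ≤ 3 + 7 * (Bsum c' D * Real.log p) + (36 + 7 * M0) / p := by
  have hT := LogEulerProduct.tailConst_nonneg 3
  have hM0 := M0_nonneg
  have hB0 := Bsum_nonneg c' D
  have hp2 : (2 : ℝ) ≤ p := by exact_mod_cast hp.two_le
  have hppos : (0 : ℝ) < p := by linarith
  have hlog : 0 ≤ Real.log p := Real.log_nonneg (by linarith)
  set ε := Bsum c' D * Real.log p with hε
  have hε0 : 0 ≤ ε := mul_nonneg hB0 hlog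
  have hLam : LamC p = 1 + 12 / (p : ℝ) := by
    rw [LamC_apply hp.ne_zero, hp.primeFactors, prod_singleton]
  have hWK : (Wt * KA c' D) p = Wt p + KA c' D p :=
    mul_apply_prime isMultiplicative_Wt.map_one (isMultiplicative_KA c' D).map_one hp
  have hW : Wt p ≤ 1 + 2 / p := by
    rw [Wt_apply, ArithmeticFunction.moebius_apply_prime hp, Nat.totient_prime hp]
    simp only [Int.reduceNeg, Int.natAbs_neg, Int.natAbs_one, Nat.cast_one, one_mul]
    push_cast [Nat.cast_sub hp.one_le]
    have hp1 : (0 : ℝ) < (p : ℝ) - 1 := by linarith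
    have e1 : 1 + 1 / ((p : ℝ) - 1) = p / (p - 1) := by
      rw [add_div' _ _ _ hp1.ne']; congr 1; ring
    have e2 : 1 / ((p : ℝ) - 1) ≤ 2 / p := by
      rw [div_le_div_iff₀ hp1 hppos]; linarith
    linarith
  have hK : KA c' D p ≤ 2 + ε + 8 * LogEulerProduct.tailConst 3 / p := by
    rw [KA_apply c' D hp.ne_zero]
    have h := Kmaj_prime_pow c' D hp one_ne_zero
    rw [pow_one] at h
    rw [h]
    refine (locK_le c' D hp 1).trans ?_
    rw [pow_one]
    have hκ : ‖Skeleton.kappaZ c' D p‖ ≤ 2 + ε := by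
      rw [hε, Skeleton.kappaZ, Bsum]; exact norm_kappa_prime_le _ _ _ hp
    have : (((1 : ℕ) : ℝ) + 1) ^ 3 * LogEulerProduct.tailConst 3 / p =
        8 * LogEulerProduct.tailConst 3 / p := by norm_num
    rw [this]; linarith
  rw [gC, pmul_apply, hLam, hWK]
  have hsum : Wt p + KA c' D p ≤ 3 + ε + M0 / p := by
    have : M0 / p = 2 / p + 8 * LogEulerProduct.tailConst 3 / p := by rw [M0]; ring
    rw [this]; linarith
  have hMp : M0 / p ≤ M0 / 2 := div_le_div_of_nonneg_left hM0 two_pos hp2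
  have hεp : 12 / (p : ℝ) * ε ≤ 6 * ε := by
    have : 12 / (p : ℝ) ≤ 6 := by rw [div_le_iff₀ hppos]; linarith
    exact mul_le_mul_of_nonneg_right this hε0
  have h12 : 0 ≤ 12 / (p : ℝ) := by positivity
  calc (1 + 12 / (p : ℝ)) * (Wt p + KA c' D p) ≤ (1 + 12 / (p : ℝ)) * (3 + ε + M0 / p) :=
        mul_le_mul_of_nonneg_left hsum (by positivity)
    _ = 3 + ε + M0 / p + 36 / p + 12 / p * ε + 12 / p * (M0 / p) := by ring
    _ ≤ 3 + ε + M0 / p + 36 / p + 6 * ε + 12 / p * (M0 / 2) := by gcongr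
    _ = 3 + 7 * ε + (36 + 7 * M0) / p := by ring

/-! ### Part 2. The window harmonic sum (the `m`-sum of `S_j`) -/

omit c' D in
/-- **The window harmonic sum.** If every `m ∈ S` satisfies `m ≥ 1` and `lo < Y·m < θ·lo`
(`Y, lo > 0`, `θ ≥ 1`; i.e. `m` lies in the window `(X, θX)`, `X = lo/Y`), then
`Σ_{m∈S} 1/m ≤ (θ − 1) + [Y < θ·lo]·Y/lo` (there are at most `(θ−1)X + 1` such `m`, each
`> X`; and `S = ∅` unless `Y < θ·lo`) — the `m`-sum of `S_j` over one window.
[cite: Zhang2022LandauSiegel, §11 p.64; §7 Prop. 7.1 p.33] -/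
theorem sum_inv_window_le {Y lo θ : ℝ} (hY : 0 < Y) (hlo : 0 < lo) (hθ : 1 ≤ θ) (S : Finset ℕ)
    (hS : ∀ m ∈ S, 1 ≤ m ∧ lo < Y * m ∧ Y * m < θ * lo) :
    ∑ m ∈ S, (1 : ℝ) / m ≤ (θ - 1) + (if Y < θ * lo then Y / lo else 0) := by
  rcases S.eq_empty_or_nonempty with rfl | ⟨m₀, hm₀⟩
  · simp only [sum_empty]
    have : 0 ≤ (if Y < θ * lo then Y / lo else 0) := by
      split_ifs
      · positivity
      · exact le_rfl
    linarith
  obtain ⟨hm₀1, -, hm₀hi⟩ := hS m₀ hm₀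
  have hYhi : Y < θ * lo := by
    have : Y ≤ Y * m₀ := le_mul_of_one_le_right hY.le (by exact_mod_cast hm₀1)
    linarith
  rw [if_pos hYhi]
  set X : ℝ := lo / Y with hX
  have hX0 : 0 < X := div_pos hlo hY
  have hmem : ∀ m ∈ S, X < m ∧ (m : ℝ) ≤ θ * X := by
    intro m hm
    obtain ⟨-, h1, h2⟩ := hS m hm
    constructor
    · rw [hX, div_lt_iff₀ hY]; linarith
    · rw [hX, mul_div_assoc', le_div_iff₀ hY]; linarith
  -- `S ⊆ Ioc ⌊X⌋ ⌊θX⌋`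
  have hsub : S ⊆ Ioc ⌊X⌋₊ ⌊θ * X⌋₊ := by
    intro m hm
    obtain ⟨h1, h2⟩ := hmem m hm
    rw [mem_Ioc]
    constructor
    · have : (⌊X⌋₊ : ℝ) < m := lt_of_le_of_lt (Nat.floor_le hX0.le) h1
      exact_mod_cast this
    · exact Nat.le_floor h2
  have hθX : 0 ≤ θ * X := by positivity
  have hcard : ((Ioc ⌊X⌋₊ ⌊θ * X⌋₊).card : ℝ) ≤ (θ - 1) * X + 1 := by
    rw [Nat.card_Ioc]
    have hle : ⌊X⌋₊ ≤ ⌊θ * X⌋₊ :=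
      Nat.floor_le_floor (le_mul_of_one_le_left hX0.le hθ)
    rw [Nat.cast_sub hle]
    have h1 : (⌊θ * X⌋₊ : ℝ) ≤ θ * X := Nat.floor_le hθX
    have h2 : X < (⌊X⌋₊ : ℝ) + 1 := Nat.lt_floor_add_one X
    linarith
  -- each term is `≤ 1/X`
  calc ∑ m ∈ S, (1 : ℝ) / m ≤ ∑ m ∈ S, (1 : ℝ) / X :=
        sum_le_sum fun m hm => (one_div_le_one_div_of_le hX0 (hmem m hm).1.le)
    _ = (S.card : ℝ) * (1 / X) := by rw [sum_const, nsmul_eq_mul]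
    _ ≤ ((Ioc ⌊X⌋₊ ⌊θ * X⌋₊).card : ℝ) * (1 / X) := by
        gcongr
    _ ≤ ((θ - 1) * X + 1) * (1 / X) := by gcongr
    _ = (θ - 1) + Y / lo := by
        rw [hX]
        field_simp

/-! ### Part 3. The ratio `θ = η₊/η₋ = e^{2𝓛⁻¹⁰}` and the `n`-window log-mean of `gC` -/

omit c' in
/-- `xη₊ = θ·(xη₋)` with `θ = η₊/η₋ = e^{2𝓛⁻¹⁰}` (`η± = e^{±𝓛⁻¹⁰}`, (11.3)).
[cite: Zhang2022LandauSiegel, §11 p.64] -/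
theorem etaPM_one_eq_mul (x : ℝ) :
    x * etaPM D 1 = Real.exp (2 * (ell D ^ 10)⁻¹) * (x * etaPM D (-1)) := by
  have h : (1 : ℝ) * (ell D ^ 10)⁻¹ = 2 * (ell D ^ 10)⁻¹ + (-1) * (ell D ^ 10)⁻¹ := by ring
  rw [etaPM, etaPM, h, Real.exp_add]
  ring

omit c' in
/-- For `𝓛 ≥ 2`: `2𝓛⁻¹⁰ ≤ θ − 1 ≤ 4𝓛⁻¹⁰`, in particular `1 < θ ≤ 2` (`θ = e^{2𝓛⁻¹⁰}`).
[cite: Zhang2022LandauSiegel, §11 p.64] -/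
theorem theta_bounds (hL : 2 ≤ ell D) :
    2 * (ell D ^ 10)⁻¹ ≤ Real.exp (2 * (ell D ^ 10)⁻¹) - 1 ∧
      Real.exp (2 * (ell D ^ 10)⁻¹) - 1 ≤ 4 * (ell D ^ 10)⁻¹ ∧
      1 < Real.exp (2 * (ell D ^ 10)⁻¹) ∧ Real.exp (2 * (ell D ^ 10)⁻¹) ≤ 2 := by
  set u : ℝ := (ell D ^ 10)⁻¹ with hu
  have hL10 : (1024 : ℝ) ≤ ell D ^ 10 := by
    calc (1024 : ℝ) = 2 ^ 10 := by norm_num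
      _ ≤ ell D ^ 10 := pow_le_pow_left₀ (by norm_num) hL 10
  have hu0 : 0 < u := by rw [hu]; positivity
  have hu1 : u ≤ 1 / 1024 := by
    rw [hu, ← one_div]; exact one_div_le_one_div_of_le (by norm_num) hL10
  have h1 : 2 * u ≤ Real.exp (2 * u) - 1 := by linarith [Real.add_one_le_exp (2 * u)]
  have h2 : Real.exp (2 * u) - 1 ≤ 4 * u := by
    have h2u : (0 : ℝ) < 2 * u := by linarith
    have hx : |2 * u| ≤ 1 := by rw [abs_of_pos h2u]; linarith
    have h := Real.abs_exp_sub_one_le hx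
    rw [abs_of_pos h2u] at h
    linarith [le_abs_self (Real.exp (2 * u) - 1)]
  refine ⟨h1, h2, ?_, ?_⟩
  · exact Real.one_lt_exp_iff.mpr (by positivity)
  · linarith

omit c' in
/-- `𝓛 ≥ L₀` once `D ≥ ⌈e^{L₀}⌉`. [folklore] -/
private theorem le_ell_of_ceil_exp_le {L₀ : ℝ} {D : ℕ} (hD : ⌈Real.exp L₀⌉₊ ≤ D) : L₀ ≤ ell D := by
  have hexp : Real.exp L₀ ≤ D := le_trans (Nat.le_ceil _) (by exact_mod_cast hD)
  rw [ell]
  exact (Real.le_log_iff_exp_le (lt_of_lt_of_le (Real.exp_pos _) hexp)).mpr hexp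

omit D in
/-- The prime bound of `gC` in the shape `a + K log p + M/p` with `a = 3`, `K = 7B`,
`M = 36 + 7M₀`. [cite: Zhang2022LandauSiegel, §7 p.33] -/
theorem gC_prime_le_aKM (D : ℕ) {p : ℕ} (hp : p.Prime) :
    gC c' D p ≤ ((3 : ℕ) : ℝ) + 7 * Bsum c' D * Real.log p + (36 + 7 * M0) / p := by
  have h := gC_prime_le_sharp c' D hp
  push_cast
  linarith

/-- **The `n`-window log-mean of the majorant: `Σ_{X<n<θX} gC(n)/n ≤ C_G·𝓛⁸`** uniformly in
`0 < X ≤ P`, for `D ≥ D₀(c′)`, with an absolute `C_G`. For `X ≥ 𝓛¹⁴` this is Shiu's theorem for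
`gC` (tree `XiZeroMajorant.gC_window_div_le`, exponent `3`: `(θ−1)(log X)² ≤ 4𝓛⁻¹⁰·𝓛¹⁸`); for
`X < 𝓛¹⁴` the whole logarithmic sum up to `2𝓛¹⁴` is `O((log 𝓛)³)` by the Euler-product majorant.
[cite: Zhang2022LandauSiegel, §11 p.64; §7 p.33] -/
theorem window_gC_div_le : ∃ C : ℝ, 0 ≤ C ∧ ∀ c' : ℝ, ∃ D₀ : ℕ, ∀ D : ℕ, D₀ ≤ D →
    ∀ X : ℝ, 0 < X → X ≤ bigP D → ∀ S : Finset ℕ,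
      (∀ n ∈ S, 1 ≤ n ∧ X < n ∧ (n : ℝ) < Real.exp (2 * (ell D ^ 10)⁻¹) * X) →
      ∑ n ∈ S, gC c' D n / n ≤ C * ell D ^ 8 := by
  obtain ⟨C₀, x₀, hC₀, hx₀2, hW⟩ := gC_window_div_le
  have hT3 := LogEulerProduct.tailConst_nonneg 3
  have hT4 := LogEulerProduct.tailConst_nonneg 4
  have hM0 := M0_nonneg
  set E₀ : ℝ := Real.exp (48 + 7 * M0 + 126 * π) with hE₀
  set E₁ : ℝ := Real.exp (4 * (3 : ℕ) + 1071 * π + (36 + 7 * M0) +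
    7 * (2 + LogEulerProduct.tailConst 3) * LogEulerProduct.tailConst 4) with hE₁
  refine ⟨4 * C₀ * E₀ + 4913 * E₁, by positivity, fun c' => ?_⟩
  refine ⟨max ⌈Real.exp (5 * |c'| * π + 3)⌉₊ ⌈Real.exp x₀⌉₊, fun D hD X hX0 hXP S hS => ?_⟩
  obtain ⟨hL3, hB⟩ := three_le_ell_and_Bsum_le (le_trans (le_max_left _ _) hD)
  have hLx₀ : x₀ ≤ ell D := le_ell_of_ceil_exp_le (le_trans (le_max_right _ _) hD)
  set ℓ : ℝ := ell D with hℓ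
  have hℓ1 : 1 ≤ ℓ := by linarith
  have hℓ0 : 0 < ℓ := by linarith
  have hB0 : 0 ≤ Bsum c' D := Bsum_nonneg c' D
  have hK : 0 ≤ 7 * Bsum c' D := by positivity
  have hM : (0 : ℝ) ≤ 36 + 7 * M0 := by positivity
  obtain ⟨hθlo, hθhi, hθ1, hθ2⟩ := theta_bounds D (by linarith : 2 ≤ ell D)
  set θ : ℝ := Real.exp (2 * (ell D ^ 10)⁻¹) with hθ
  have hl9 : (2 : ℝ) ≤ ℓ ^ 9 := by
    calc (2 : ℝ) ≤ 2 ^ 9 := by norm_num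
      _ ≤ ℓ ^ 9 := pow_le_pow_left₀ (by norm_num) (by linarith) 9
  have hlogP : Real.log (bigP D) = ℓ ^ 9 := by rw [bigP, Real.log_exp]
  have hgp : ∀ p : ℕ, p.Prime → (p : ℝ) ≤ X →
      gC c' D p ≤ ((3 : ℕ) : ℝ) + 7 * Bsum c' D * Real.log p + (36 + 7 * M0) / p :=
    fun p hp _ => gC_prime_le_aKM c' D hp
  have hS0 : ∀ n ∈ S, 0 ≤ gC c' D n / n := fun n _ =>
    div_nonneg (gC_nonneg c' D n) (Nat.cast_nonneg n)
  have hE₀0 : 0 ≤ E₀ := (Real.exp_pos _).le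
  have hE₁0 : 0 ≤ E₁ := (Real.exp_pos _).le
  have hl8 : (1 : ℝ) ≤ ℓ ^ 8 := one_le_pow₀ hℓ1
  rcases le_or_gt (ℓ ^ 14) X with hX14 | hX14
  · -- Shiu regime `X ≥ 𝓛¹⁴`
    have hXℓ : ℓ ≤ X := le_trans (le_self_pow₀ hℓ1 (by norm_num)) hX14
    have hXx₀ : x₀ ≤ X := hLx₀.trans hXℓ
    have hX2 : 2 ≤ X := hx₀2.trans hXx₀
    have hX1 : 1 ≤ X := by linarith
    have hlogX0 : 0 < Real.log X := Real.log_pos (by linarith)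
    have hlogXP : Real.log X ≤ ℓ ^ 9 := by rw [← hlogP]; exact Real.log_le_log hX0 hXP
    -- `X^{1/4} ≤ (θ - 1)X`
    have hy : X ^ (1 / 4 : ℝ) ≤ (θ - 1) * X := by
      have h34 : X ^ (-(3 / 4) : ℝ) ≤ 2 * (ell D ^ 10)⁻¹ := by
        have h1 : X ^ (-(3 / 4) : ℝ) ≤ (ℓ ^ 14) ^ (-(3 / 4) : ℝ) :=
          Real.rpow_le_rpow_of_nonpos (by positivity) hX14 (by norm_num)
        have h2 : (ℓ ^ 14) ^ (-(3 / 4) : ℝ) = ℓ ^ (-(21 / 2) : ℝ) := by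
          rw [← Real.rpow_natCast ℓ 14, ← Real.rpow_mul hℓ0.le]; norm_num
        have h3 : ℓ ^ (-(21 / 2) : ℝ) ≤ ℓ ^ (-(10 : ℝ)) :=
          Real.rpow_le_rpow_of_exponent_le hℓ1 (by norm_num)
        have h4 : ℓ ^ (-(10 : ℝ)) = (ell D ^ 10)⁻¹ := by
          rw [Real.rpow_neg hℓ0.le, hℓ]; norm_num
        calc X ^ (-(3 / 4) : ℝ) ≤ (ell D ^ 10)⁻¹ := by rw [← h4]; exact h1.trans (h2 ▸ h3)
          _ ≤ 2 * (ell D ^ 10)⁻¹ := by linarith [inv_nonneg.mpr (pow_nonneg hℓ0.le 10)]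
      have hsplit : X ^ (1 / 4 : ℝ) = X * X ^ (-(3 / 4) : ℝ) := by
        rw [show (1 / 4 : ℝ) = 1 + -(3 / 4) by norm_num, Real.rpow_add hX0, Real.rpow_one]
      rw [hsplit, mul_comm]
      exact mul_le_mul_of_nonneg_right (h34.trans hθlo) hX0.le
    have hwin := hW c' D 3 (7 * Bsum c' D) (36 + 7 * M0) hK hM X θ hXx₀ hθ1 hθ2 hy hgp
    -- `S` lies inside the Shiu window
    have hsub : S ⊆ (Icc 1 ⌊θ * X⌋₊).filter (fun n : ℕ => X < n) := by
      intro n hn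
      obtain ⟨h1, h2, h3⟩ := hS n hn
      rw [mem_filter, mem_Icc]
      exact ⟨⟨h1, Nat.le_floor h3.le⟩, h2⟩
    -- the size of the constant
    have hKlog : 7 * Bsum c' D * Real.log (4 * X) ≤ 126 * π := by
      have hlog4X : Real.log (4 * X) ≤ 2 * ℓ ^ 9 := by
        rw [Real.log_mul (by norm_num) hX0.ne']
        have : Real.log 4 ≤ 2 := by
          have h := Real.log_le_sub_one_of_pos (show (0:ℝ) < 4 by norm_num)
          have h2 : Real.log 4 = 2 * Real.log 2 := by
            rw [show (4:ℝ) = 2 ^ 2 by norm_num, Real.log_pow]; ring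
          have h3 := Real.log_le_sub_one_of_pos (show (0:ℝ) < 2 by norm_num)
          linarith
        linarith
      have hlog0 : 0 ≤ Real.log (4 * X) := Real.log_nonneg (by linarith)
      calc 7 * Bsum c' D * Real.log (4 * X) ≤ 7 * (9 * π / ℓ ^ 9) * (2 * ℓ ^ 9) := by
            gcongr
        _ = 126 * π := by field_simp; ring
    have hexp : Real.exp (4 * (3 : ℕ) + 7 * Bsum c' D * Real.log (4 * X) + (36 + 7 * M0)) ≤ E₀ := by
      rw [hE₀]; refine Real.exp_le_exp.mpr ?_; push_cast; linarith
    have hlog2 : Real.log X ^ (3 : ℕ) / Real.log X = Real.log X ^ 2 := by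
      field_simp
    have hlogsq : Real.log X ^ 2 ≤ ℓ ^ 18 := by
      calc Real.log X ^ 2 ≤ (ℓ ^ 9) ^ 2 := pow_le_pow_left₀ hlogX0.le hlogXP 2
        _ = ℓ ^ 18 := by ring
    calc ∑ n ∈ S, gC c' D n / n
        ≤ ∑ n ∈ (Icc 1 ⌊θ * X⌋₊).filter (fun n : ℕ => X < n), gC c' D n / n :=
          sum_le_sum_of_subset_of_nonneg hsub fun n _ _ =>
            div_nonneg (gC_nonneg c' D n) (Nat.cast_nonneg n)
      _ ≤ C₀ * Real.exp (4 * (3 : ℕ) + 7 * Bsum c' D * Real.log (4 * X) + (36 + 7 * M0)) *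
            Real.log X ^ (3 : ℕ) / Real.log X * (θ - 1) := hwin
      _ = C₀ * Real.exp (4 * (3 : ℕ) + 7 * Bsum c' D * Real.log (4 * X) + (36 + 7 * M0)) *
            Real.log X ^ 2 * (θ - 1) := by rw [mul_div_assoc, hlog2]
      _ ≤ C₀ * E₀ * ℓ ^ 18 * (4 * (ell D ^ 10)⁻¹) := by
          gcongr
      _ = 4 * C₀ * E₀ * ℓ ^ 8 := by rw [hℓ]; field_simp
      _ ≤ (4 * C₀ * E₀ + 4913 * E₁) * ℓ ^ 8 := by nlinarith
  · -- small `X < 𝓛¹⁴`: the whole logarithmic sum up to `2𝓛¹⁴`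
    set X₁ : ℕ := ⌊2 * ℓ ^ 14⌋₊ with hX₁
    have hl14 : (1 : ℝ) ≤ ℓ ^ 14 := one_le_pow₀ hℓ1
    have hX₁2 : 2 ≤ X₁ := by
      rw [hX₁]; exact Nat.le_floor (by push_cast; linarith)
    have hX₁le : (X₁ : ℝ) ≤ 2 * ℓ ^ 14 := Nat.floor_le (by positivity)
    have hX₁pos : (0 : ℝ) < X₁ := by exact_mod_cast (by omega : 0 < X₁)
    have hsub : S ⊆ Icc 1 X₁ := by
      intro n hn
      obtain ⟨h1, -, h3⟩ := hS n hn
      rw [mem_Icc]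
      refine ⟨h1, Nat.le_floor ?_⟩
      have h2X : θ * X ≤ 2 * X := mul_le_mul_of_nonneg_right hθ2 hX0.le
      linarith
    have hmaj := sum_div_le_gen (f := fun n => gC c' D n) (isMultiplicative_gC c' D).map_one
      (fun m n hmn => (isMultiplicative_gC c' D).map_mul_of_coprime hmn) (gC_nonneg c' D)
      (a := 3) (d := 4) (K := 7 * Bsum c' D) (M := 36 + 7 * M0)
      (C₅ := 7 * (2 + LogEulerProduct.tailConst 3)) hK hM (by positivity) hX₁2
      (fun p hp => summable_gC_local c' D hp)
      (fun p hp _ => gC_prime_le_aKM c' D hp)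
      (fun p ν hp _ => gC_prime_pow_le c' D hp ν)
    -- the size of the constant
    have hlogℓ : Real.log ℓ ≤ ℓ := (Real.log_le_sub_one_of_pos hℓ0).trans (by linarith)
    have hlog8X₁ : Real.log (4 * X₁) ≤ 17 * ℓ := by
      have h8 : (4 : ℝ) * X₁ ≤ 8 * ℓ ^ 14 := by linarith
      calc Real.log (4 * X₁) ≤ Real.log (8 * ℓ ^ 14) := Real.log_le_log (by positivity) h8
        _ = Real.log 8 + 14 * Real.log ℓ := by
            rw [Real.log_mul (by norm_num) (by positivity), Real.log_pow]; push_cast; ring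
        _ ≤ 3 + 14 * ℓ := by
            have : Real.log 8 ≤ 3 := by
              rw [show (8:ℝ) = 2 ^ 3 by norm_num, Real.log_pow]
              have h3 := Real.log_le_sub_one_of_pos (show (0:ℝ) < 2 by norm_num)
              push_cast; linarith
            linarith
        _ ≤ 17 * ℓ := by linarith
    have hlogX₁ : Real.log X₁ ≤ 17 * ℓ :=
      le_trans (Real.log_le_log hX₁pos (by linarith)) hlog8X₁
    have hlogX₁0 : 0 ≤ Real.log X₁ := Real.log_nonneg (by exact_mod_cast (by omega : 1 ≤ X₁))
    have hX₁2r : (2 : ℝ) ≤ X₁ := by exact_mod_cast hX₁2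
    have hKlog : 7 * Bsum c' D * Real.log (4 * X₁) ≤ 1071 * π := by
      have hlog0 : 0 ≤ Real.log (4 * X₁) := Real.log_nonneg (by linarith)
      calc 7 * Bsum c' D * Real.log (4 * X₁) ≤ 7 * (9 * π / ℓ ^ 9) * (17 * ℓ) := by gcongr
        _ = 1071 * π * (ℓ / ℓ ^ 9) := by ring
        _ ≤ 1071 * π * 1 := by
            refine mul_le_mul_of_nonneg_left ?_ (by positivity)
            rw [div_le_one (by positivity)]
            exact le_self_pow₀ hℓ1 (by norm_num)
        _ = 1071 * π := mul_one _
    have hexp : Real.exp (4 * (3 : ℕ) + 7 * Bsum c' D * Real.log (4 * X₁) + (36 + 7 * M0) +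
        7 * (2 + LogEulerProduct.tailConst 3) * LogEulerProduct.tailConst 4) ≤ E₁ := by
      rw [hE₁]; exact Real.exp_le_exp.mpr (by linarith)
    have hlog3 : Real.log X₁ ^ (3 : ℕ) ≤ 4913 * ℓ ^ 8 := by
      calc Real.log X₁ ^ (3 : ℕ) ≤ (17 * ℓ) ^ 3 := pow_le_pow_left₀ hlogX₁0 hlogX₁ 3
        _ = 4913 * ℓ ^ 3 := by ring
        _ ≤ 4913 * ℓ ^ 8 := by
            have : ℓ ^ 3 ≤ ℓ ^ 8 := pow_le_pow_right₀ hℓ1 (by norm_num)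
            linarith
    calc ∑ n ∈ S, gC c' D n / n ≤ ∑ n ∈ Icc 1 X₁, gC c' D n / n :=
          sum_le_sum_of_subset_of_nonneg hsub fun n _ _ =>
            div_nonneg (gC_nonneg c' D n) (Nat.cast_nonneg n)
      _ ≤ Real.exp (4 * (3 : ℕ) + 7 * Bsum c' D * Real.log (4 * X₁) + (36 + 7 * M0) +
            7 * (2 + LogEulerProduct.tailConst 3) * LogEulerProduct.tailConst 4) *
            Real.log X₁ ^ (3 : ℕ) := hmaj
      _ ≤ E₁ * (4913 * ℓ ^ 8) := mul_le_mul hexp hlog3 (pow_nonneg hlogX₁0 3) hE₁0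
      _ = 4913 * E₁ * ℓ ^ 8 := by ring
      _ ≤ (4 * C₀ * E₀ + 4913 * E₁) * ℓ ^ 8 := by
          have h0 : 0 ≤ 4 * C₀ * E₀ * ℓ ^ 8 := by positivity
          nlinarith [h0]

/-! ### Part 4. The `m`-sum and the `n`-sum of `S_j` at window-supported sequences -/

omit c' in
/-- Pointwise insertion of the windows: if `‖a‖ ≤ B` and `a(k) ≠ 0` forces `k` into one of the
windows `(xη₋, xη₊)`, `x ∈ xs`, then `‖a(k)‖·t ≤ Σ_{x∈xs} [xη₋ < k < xη₊]·B·t` (`t ≥ 0`).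
[cite: Zhang2022LandauSiegel, §11 p.64] -/
theorem norm_mul_le_sum_ite {xs : Finset ℝ} {B : ℝ} (hB : 0 ≤ B) {a : ℕ → ℂ}
    (ha : ∀ n, ‖a n‖ ≤ B)
    (hsupp : ∀ n, a n ≠ 0 → ∃ x ∈ xs, x * etaPM D (-1) < n ∧ (n : ℝ) < x * etaPM D 1)
    (k : ℕ) {t : ℝ} (ht : 0 ≤ t) :
    ‖a k‖ * t ≤ ∑ x ∈ xs,
      (if x * etaPM D (-1) < k ∧ (k : ℝ) < x * etaPM D 1 then B * t else 0) := by
  have h0le : ∀ x ∈ xs, 0 ≤ (if x * etaPM D (-1) < k ∧ (k : ℝ) < x * etaPM D 1 then B * t else 0) :=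
    fun x _ => by split_ifs <;> [exact mul_nonneg hB ht; exact le_rfl]
  by_cases h0 : a k = 0
  · rw [h0, norm_zero, zero_mul]
    exact sum_nonneg h0le
  · obtain ⟨x, hx, hwin⟩ := hsupp k h0
    calc ‖a k‖ * t ≤ B * t := mul_le_mul_of_nonneg_right (ha k) ht
      _ = (if x * etaPM D (-1) < k ∧ (k : ℝ) < x * etaPM D 1 then B * t else 0) := by
          rw [if_pos hwin]
      _ ≤ ∑ x ∈ xs, (if x * etaPM D (-1) < k ∧ (k : ℝ) < x * etaPM D 1 then B * t else 0) :=
          single_le_sum (f := fun x =>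
            if x * etaPM D (-1) < k ∧ (k : ℝ) < x * etaPM D 1 then B * t else 0) h0le hx

/-- **The `m`-sum over the windows**: for `‖𝐚₁‖ ≤ B₁` supported on the windows `(xη₋, xη₊)`,
`x ∈ xs` (`x > 0`), and `d, r ≥ 1`,
`‖Σ_m a₁(drm)m^{−(1−β_j)}‖ ≤ B₁·Σ_{x∈xs} [(θ−1) + [dr < xη₊]·dr/(xη₋)]` (`|m^{−(1−β_j)}| = 1/m`
and `sum_inv_window_le` per window). [cite: Zhang2022LandauSiegel, §11 p.64; §7 Prop. 7.1 p.33] -/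
theorem norm_msum_window_le (hL : 2 ≤ ell D) (N j : ℕ) (xs : Finset ℝ)
    (hxs : ∀ x ∈ xs, 0 < x) {B₁ : ℝ} (hB₁ : 0 ≤ B₁) {a₁ : ℕ → ℂ} (ha₁ : ∀ n, ‖a₁ n‖ ≤ B₁)
    (hsupp : ∀ n, a₁ n ≠ 0 → ∃ x ∈ xs, x * etaPM D (-1) < n ∧ (n : ℝ) < x * etaPM D 1)
    {d r : ℕ} (hd : d ≠ 0) (hr : r ≠ 0) :
    ‖∑ m ∈ Ico 1 N, a₁ (d * r * m) / (m : ℂ) ^ (1 - betaJ c' D j)‖ ≤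
      B₁ * ∑ x ∈ xs, ((Real.exp (2 * (ell D ^ 10)⁻¹) - 1) +
        if ((d * r : ℕ) : ℝ) < x * etaPM D 1 then ((d * r : ℕ) : ℝ) / (x * etaPM D (-1)) else 0) := by
  obtain ⟨-, -, hθ1, -⟩ := theta_bounds D hL
  have hY : (0 : ℝ) < ((d * r : ℕ) : ℝ) := by
    exact_mod_cast Nat.pos_of_ne_zero (mul_ne_zero hd hr)
  -- step 1: `|m^{−(1−β_j)}| = 1/m`
  have h1 : ‖∑ m ∈ Ico 1 N, a₁ (d * r * m) / (m : ℂ) ^ (1 - betaJ c' D j)‖ ≤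
      ∑ m ∈ Ico 1 N, ‖a₁ (d * r * m)‖ * (1 / (m : ℝ)) := by
    refine (norm_sum_le _ _).trans (sum_le_sum fun m hm => ?_)
    have hmpos : 0 < m := (mem_Ico.mp hm).1
    rw [norm_div, Complex.norm_natCast_cpow_of_pos hmpos, one_sub_betaJ_re, Real.rpow_one,
      div_eq_mul_one_div]
  -- step 2: insert the windows
  have h2 : ∑ m ∈ Ico 1 N, ‖a₁ (d * r * m)‖ * (1 / (m : ℝ)) ≤
      ∑ m ∈ Ico 1 N, ∑ x ∈ xs,
        (if x * etaPM D (-1) < (d * r * m : ℕ) ∧ ((d * r * m : ℕ) : ℝ) < x * etaPM D 1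
          then B₁ * (1 / (m : ℝ)) else 0) :=
    sum_le_sum fun m _ => norm_mul_le_sum_ite D hB₁ ha₁ hsupp (d * r * m) (by positivity)
  rw [sum_comm] at h2
  -- step 3: each window by `sum_inv_window_le`
  have h3 : ∀ x ∈ xs, ∑ m ∈ Ico 1 N,
      (if x * etaPM D (-1) < (d * r * m : ℕ) ∧ ((d * r * m : ℕ) : ℝ) < x * etaPM D 1
        then B₁ * (1 / (m : ℝ)) else 0) ≤
      B₁ * ((Real.exp (2 * (ell D ^ 10)⁻¹) - 1) +
        if ((d * r : ℕ) : ℝ) < x * etaPM D 1 then ((d * r : ℕ) : ℝ) / (x * etaPM D (-1)) else 0) := by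
    intro x hx
    have hlo : 0 < x * etaPM D (-1) := mul_pos (hxs x hx) (Real.exp_pos _)
    rw [← sum_filter, ← mul_sum]
    refine mul_le_mul_of_nonneg_left ?_ hB₁
    have hmem : ∀ m ∈ (Ico 1 N).filter (fun m =>
        x * etaPM D (-1) < (d * r * m : ℕ) ∧ ((d * r * m : ℕ) : ℝ) < x * etaPM D 1),
        1 ≤ m ∧ x * etaPM D (-1) < ((d * r : ℕ) : ℝ) * m ∧
          ((d * r : ℕ) : ℝ) * m < Real.exp (2 * (ell D ^ 10)⁻¹) * (x * etaPM D (-1)) := by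
      intro m hm
      rw [mem_filter, mem_Ico] at hm
      obtain ⟨⟨hm1, -⟩, hlo', hhi'⟩ := hm
      have e : ((d * r * m : ℕ) : ℝ) = ((d * r : ℕ) : ℝ) * m := by push_cast; ring
      rw [e] at hlo' hhi'
      rw [etaPM_one_eq_mul D x] at hhi'
      exact ⟨hm1, hlo', hhi'⟩
    have hwin := sum_inv_window_le hY hlo hθ1.le _ hmem
    rw [← etaPM_one_eq_mul D x] at hwin
    exact hwin
  calc ‖∑ m ∈ Ico 1 N, a₁ (d * r * m) / (m : ℂ) ^ (1 - betaJ c' D j)‖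
      ≤ ∑ m ∈ Ico 1 N, ‖a₁ (d * r * m)‖ * (1 / (m : ℝ)) := h1
    _ ≤ _ := h2
    _ ≤ ∑ x ∈ xs, B₁ * ((Real.exp (2 * (ell D ^ 10)⁻¹) - 1) +
        if ((d * r : ℕ) : ℝ) < x * etaPM D 1 then ((d * r : ℕ) : ℝ) / (x * etaPM D (-1)) else 0) :=
        sum_le_sum h3
    _ = _ := by rw [← mul_sum]

omit c' in
/-- `η₋ ≤ 1`. [cite: Zhang2022LandauSiegel, §11 (11.3)] -/
theorem etaPM_neg_one_le_one : etaPM D (-1) ≤ 1 := by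
  rw [etaPM]
  refine Real.exp_le_one_iff.mpr ?_
  have : 0 ≤ (ell D ^ 10)⁻¹ := inv_nonneg.mpr (pow_nonneg (Real.log_natCast_nonneg D) 10)
  linarith

/-- **The `n`-sum over the windows**: with an absolute `C` and for `D ≥ D₀(c′)`: for
`‖𝐚₂‖ ≤ B₂` supported on the windows `(xη₋, xη₊)`, `x ∈ xs` (`0 < x ≤ P`), and `d, r ≥ 1`,
`‖Σ_n a₂(drn)ξ₀ⱼ(n;d,r)/n‖ ≤ B₂·#xs·C·𝓛⁸` (`|ξ₀ⱼ| ≤ gC` and `window_gC_div_le` per window, at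
`X = xη₋/(dr) ≤ P`). [cite: Zhang2022LandauSiegel, §11 p.64; §7 Prop. 7.1 p.33] -/
theorem norm_nsum_window_le : ∃ C : ℝ, 0 ≤ C ∧ ∀ c' : ℝ, ∃ D₀ : ℕ, ∀ D : ℕ, D₀ ≤ D →
    ∀ (N j : ℕ) (xs : Finset ℝ), (∀ x ∈ xs, 0 < x ∧ x ≤ bigP D) →
    ∀ (B₂ : ℝ), 0 ≤ B₂ → ∀ a₂ : ℕ → ℂ, (∀ n, ‖a₂ n‖ ≤ B₂) →
      (∀ n, a₂ n ≠ 0 → ∃ x ∈ xs, x * etaPM D (-1) < n ∧ (n : ℝ) < x * etaPM D 1) →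
      ∀ d r : ℕ, d ≠ 0 → r ≠ 0 →
      ‖∑ n ∈ Ico 1 N, a₂ (d * r * n) * xiZero c' D j n d r / (n : ℂ)‖ ≤
        B₂ * (xs.card * (C * ell D ^ 8)) := by
  obtain ⟨C, hC, hG⟩ := window_gC_div_le
  refine ⟨C, hC, fun c' => ?_⟩
  obtain ⟨D₀, hD₀⟩ := hG c'
  refine ⟨D₀, fun D hD N j xs hxs B₂ hB₂ a₂ ha₂ hsupp d r hd hr => ?_⟩
  have hY : (0 : ℝ) < ((d * r : ℕ) : ℝ) := by
    exact_mod_cast Nat.pos_of_ne_zero (mul_ne_zero hd hr)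
  have hY1 : (1 : ℝ) ≤ ((d * r : ℕ) : ℝ) := by
    exact_mod_cast Nat.pos_of_ne_zero (mul_ne_zero hd hr)
  -- step 1: `|ξ₀ⱼ| ≤ gC`
  have h1 : ‖∑ n ∈ Ico 1 N, a₂ (d * r * n) * xiZero c' D j n d r / (n : ℂ)‖ ≤
      ∑ n ∈ Ico 1 N, ‖a₂ (d * r * n)‖ * (gC c' D n / n) := by
    refine (norm_sum_le _ _).trans (sum_le_sum fun n hn => ?_)
    have hnpos : 0 < n := (mem_Ico.mp hn).1
    rw [norm_div, norm_mul, Complex.norm_natCast, mul_div_assoc]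
    exact mul_le_mul_of_nonneg_left
      (div_le_div_of_nonneg_right (norm_xiZero_le_gC c' D hnpos.ne' j d r) (Nat.cast_nonneg n))
      (norm_nonneg _)
  -- step 2: insert the windows
  have h2 : ∑ n ∈ Ico 1 N, ‖a₂ (d * r * n)‖ * (gC c' D n / n) ≤
      ∑ n ∈ Ico 1 N, ∑ x ∈ xs,
        (if x * etaPM D (-1) < (d * r * n : ℕ) ∧ ((d * r * n : ℕ) : ℝ) < x * etaPM D 1
          then B₂ * (gC c' D n / n) else 0) :=
    sum_le_sum fun n _ => norm_mul_le_sum_ite D hB₂ ha₂ hsupp (d * r * n)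
      (div_nonneg (gC_nonneg c' D n) (Nat.cast_nonneg n))
  rw [sum_comm] at h2
  -- step 3: each window by `window_gC_div_le` at `X = xη₋/(dr)`
  have h3 : ∀ x ∈ xs, ∑ n ∈ Ico 1 N,
      (if x * etaPM D (-1) < (d * r * n : ℕ) ∧ ((d * r * n : ℕ) : ℝ) < x * etaPM D 1
        then B₂ * (gC c' D n / n) else 0) ≤ B₂ * (C * ell D ^ 8) := by
    intro x hx
    obtain ⟨hx0, hxP⟩ := hxs x hx
    have hlo : 0 < x * etaPM D (-1) := mul_pos hx0 (Real.exp_pos _)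
    rw [← sum_filter, ← mul_sum]
    refine mul_le_mul_of_nonneg_left ?_ hB₂
    have hX0 : 0 < x * etaPM D (-1) / ((d * r : ℕ) : ℝ) := div_pos hlo hY
    have hXP : x * etaPM D (-1) / ((d * r : ℕ) : ℝ) ≤ bigP D := by
      calc x * etaPM D (-1) / ((d * r : ℕ) : ℝ) ≤ x * etaPM D (-1) := div_le_self hlo.le hY1
        _ ≤ x := mul_le_of_le_one_right hx0.le (etaPM_neg_one_le_one D)
        _ ≤ bigP D := hxP
    refine hD₀ D hD _ hX0 hXP _ fun n hn => ?_
    rw [mem_filter, mem_Ico] at hn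
    obtain ⟨⟨hn1, -⟩, hlo', hhi'⟩ := hn
    have e : ((d * r * n : ℕ) : ℝ) = (n : ℝ) * ((d * r : ℕ) : ℝ) := by push_cast; ring
    rw [e] at hlo' hhi'
    refine ⟨hn1, ?_, ?_⟩
    · rwa [div_lt_iff₀ hY]
    · rw [← mul_div_assoc, lt_div_iff₀ hY, ← etaPM_one_eq_mul D x]
      exact hhi'
  calc ‖∑ n ∈ Ico 1 N, a₂ (d * r * n) * xiZero c' D j n d r / (n : ℂ)‖
      ≤ ∑ n ∈ Ico 1 N, ‖a₂ (d * r * n)‖ * (gC c' D n / n) := h1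
    _ ≤ _ := h2
    _ ≤ ∑ x ∈ xs, B₂ * (C * ell D ^ 8) := sum_le_sum h3
    _ = B₂ * (xs.card * (C * ell D ^ 8)) := by rw [sum_const, nsmul_eq_mul]; ring

/-! ### Part 5. The weights `|μ(r)|λ₀ⱼ(dr)/(drφ(r))` and the window bound for `S_j` -/

/-- **The weight of `S_j`**: `‖|μ(r)|λ₀ⱼ(dr)/(drφ(r))‖ ≤ |μ(r)|Λc(d)Λc(r)/(drφ(r))` (`d, r ≥ 1`;
`|λ₀ⱼ(dr)| ≤ Λc(dr) ≤ Λc(d)Λc(r)`). [cite: Zhang2022LandauSiegel, §7 Prop. 7.1 p.33] -/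
theorem norm_weight_le {d r : ℕ} (hd : d ≠ 0) (hr : r ≠ 0) (j : ℕ) :
    ‖((ArithmeticFunction.moebius r).natAbs : ℂ) * lamZero c' D j (d * r) /
        ((d * r : ℕ) * (Nat.totient r : ℂ))‖ ≤
      ((ArithmeticFunction.moebius r).natAbs : ℝ) * (LamC d * LamC r) /
        (((d * r : ℕ) : ℝ) * (Nat.totient r : ℝ)) := by
  have hdr : d * r ≠ 0 := mul_ne_zero hd hr
  rw [norm_div, norm_mul, norm_mul, Complex.norm_natCast, Complex.norm_natCast,
    Complex.norm_natCast]
  exact div_le_div_of_nonneg_right (mul_le_mul_of_nonneg_left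
    ((norm_lamZero_le_LamC c' D hdr j).trans (LamC_mul_le hd hr)) (Nat.cast_nonneg _))
    (by positivity)

omit c' D in
/-- The weight factors: `|μ(r)|Λc(d)Λc(r)/(drφ(r)) = (Λc(d)/d)·(|μ(r)|Λc(r)/(rφ(r)))`.
[cite: Zhang2022LandauSiegel, §7 Prop. 7.1 p.33] -/
theorem weight_eq {d r : ℕ} (hd : d ≠ 0) (hr : r ≠ 0) :
    ((ArithmeticFunction.moebius r).natAbs : ℝ) * (LamC d * LamC r) /
        (((d * r : ℕ) : ℝ) * (Nat.totient r : ℝ)) =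
      (LamC d / d) * (((ArithmeticFunction.moebius r).natAbs : ℝ) * LamC r /
        ((r : ℝ) * (Nat.totient r : ℝ))) := by
  have hd' : (d : ℝ) ≠ 0 := by exact_mod_cast hd
  have hr' : (r : ℝ) ≠ 0 := by exact_mod_cast hr
  have hφ : (Nat.totient r : ℝ) ≠ 0 := by
    exact_mod_cast (Nat.totient_pos.mpr (Nat.pos_of_ne_zero hr)).ne'
  push_cast
  field_simp

omit c' D in
/-- **The total weight**: `Σ_{d,r<N} |μ(r)|Λc(d)Λc(r)/(drφ(r)) ≤ e^{16+7S₀}·log N·e^{14+7S₀}`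
(`N ≥ 2`; `Σ_dΛc(d)/d ≪ log N` and `Σ_r|μ(r)|Λc(r)/(rφ(r)) = O(1)`, tree).
[cite: Zhang2022LandauSiegel, §7 Prop. 7.1 p.33; §11 p.64] -/
theorem sum_weight_le {N : ℕ} (hN : 2 ≤ N) :
    ∑ d ∈ Ico 1 N, ∑ r ∈ Ico 1 N, ((ArithmeticFunction.moebius r).natAbs : ℝ) *
        (LamC d * LamC r) / (((d * r : ℕ) : ℝ) * (Nat.totient r : ℝ)) ≤
      Real.exp (16 + 7 * LogEulerProduct.tailConst 0) * Real.log N *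
        Real.exp (14 + 7 * LogEulerProduct.tailConst 0) := by
  have hsubN : Ico 1 N ⊆ Icc 1 N := fun n hn => by
    rw [mem_Ico] at hn; rw [mem_Icc]; omega
  have hΛ : ∑ d ∈ Ico 1 N, LamC d / d ≤
      Real.exp (16 + 7 * LogEulerProduct.tailConst 0) * Real.log N := by
    have h := sum_LamC_div_le hN
    have e : Real.exp (4 * (1 : ℕ) + 0 * Real.log (4 * N) + 12 + 7 * LogEulerProduct.tailConst 0) *
        Real.log N ^ (1 : ℕ) = Real.exp (16 + 7 * LogEulerProduct.tailConst 0) * Real.log N := by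
      norm_num
    rw [e] at h
    exact (sum_le_sum_of_subset_of_nonneg hsubN fun d _ _ =>
      div_nonneg (LamC_nonneg d) (Nat.cast_nonneg d)).trans h
  have hμ : ∑ r ∈ Ico 1 N, ((ArithmeticFunction.moebius r).natAbs : ℝ) * LamC r /
      ((r : ℝ) * (Nat.totient r : ℝ)) ≤ Real.exp (14 + 7 * LogEulerProduct.tailConst 0) :=
    (sum_le_sum_of_subset_of_nonneg hsubN fun r _ _ => by positivity [LamC_nonneg r]).trans
      (sum_moebius_LamC_div_le N)
  have hμ0 : 0 ≤ ∑ r ∈ Ico 1 N, ((ArithmeticFunction.moebius r).natAbs : ℝ) * LamC r /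
      ((r : ℝ) * (Nat.totient r : ℝ)) := sum_nonneg fun r _ => by positivity [LamC_nonneg r]
  have hN0 : (1 : ℝ) ≤ N := by exact_mod_cast (by omega : 1 ≤ N)
  have hlog0 : 0 ≤ Real.log N := Real.log_nonneg hN0
  calc ∑ d ∈ Ico 1 N, ∑ r ∈ Ico 1 N, ((ArithmeticFunction.moebius r).natAbs : ℝ) *
          (LamC d * LamC r) / (((d * r : ℕ) : ℝ) * (Nat.totient r : ℝ))
      = ∑ d ∈ Ico 1 N, ∑ r ∈ Ico 1 N, (LamC d / d) *
          (((ArithmeticFunction.moebius r).natAbs : ℝ) * LamC r / ((r : ℝ) * (Nat.totient r : ℝ))) := by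
        refine sum_congr rfl fun d hd => sum_congr rfl fun r hr => ?_
        have hd0 : d ≠ 0 := by have := (mem_Ico.mp hd).1; omega
        have hr0 : r ≠ 0 := by have := (mem_Ico.mp hr).1; omega
        exact weight_eq hd0 hr0
    _ = (∑ d ∈ Ico 1 N, LamC d / d) * ∑ r ∈ Ico 1 N,
          ((ArithmeticFunction.moebius r).natAbs : ℝ) * LamC r / ((r : ℝ) * (Nat.totient r : ℝ)) := by
        rw [sum_mul_sum]
    _ ≤ (Real.exp (16 + 7 * LogEulerProduct.tailConst 0) * Real.log N) *
          Real.exp (14 + 7 * LogEulerProduct.tailConst 0) :=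
        mul_le_mul hΛ hμ hμ0 (by positivity)

omit c' D in
/-- **The weight near a window edge**: for `Z ≥ 0`, `lo > 0`,
`Σ_{d,r<N} |μ(r)|Λc(d)Λc(r)/(drφ(r))·[dr < Z]·dr/lo ≤ e^{12+6S₀}e^{14+7S₀}·Z/lo`
(`Σ_{d<Z/r}Λc(d) ≤ e^{12+6S₀}Z/r`, then `Σ_r|μ(r)|Λc(r)/(rφ(r)) = O(1)`; tree `Section11LamCSums`).
[cite: Zhang2022LandauSiegel, §11 p.64; §7 Prop. 7.1 p.33] -/
theorem sum_weight_ite_le (N : ℕ) {Z lo : ℝ} (hZ : 0 ≤ Z) (hlo : 0 < lo) :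
    ∑ d ∈ Ico 1 N, ∑ r ∈ Ico 1 N, ((ArithmeticFunction.moebius r).natAbs : ℝ) *
        (LamC d * LamC r) / (((d * r : ℕ) : ℝ) * (Nat.totient r : ℝ)) *
        (if ((d * r : ℕ) : ℝ) < Z then ((d * r : ℕ) : ℝ) / lo else 0) ≤
      Real.exp (12 + 6 * LogEulerProduct.tailConst 0) *
        Real.exp (14 + 7 * LogEulerProduct.tailConst 0) * Z / lo := by
  set C₃ : ℝ := Real.exp (12 + 6 * LogEulerProduct.tailConst 0) with hC₃
  set C₄ : ℝ := Real.exp (14 + 7 * LogEulerProduct.tailConst 0) with hC₄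
  have hC₃0 : 0 ≤ C₃ := (Real.exp_pos _).le
  have hsubN : Ico 1 N ⊆ Icc 1 N := fun n hn => by
    rw [mem_Ico] at hn; rw [mem_Icc]; omega
  -- termwise: `w·[dr<Z]·dr/lo = (|μ(r)|Λc(r)/φ(r)/lo)·[dr<Z]Λc(d)`
  have hterm : ∀ d ∈ Ico 1 N, ∀ r ∈ Ico 1 N,
      ((ArithmeticFunction.moebius r).natAbs : ℝ) * (LamC d * LamC r) /
          (((d * r : ℕ) : ℝ) * (Nat.totient r : ℝ)) *
          (if ((d * r : ℕ) : ℝ) < Z then ((d * r : ℕ) : ℝ) / lo else 0) =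
        (((ArithmeticFunction.moebius r).natAbs : ℝ) * LamC r / (Nat.totient r : ℝ) / lo) *
          (if ((d * r : ℕ) : ℝ) < Z then LamC d else 0) := by
    intro d hd r hr
    have hd0 : (d : ℝ) ≠ 0 := by have := (mem_Ico.mp hd).1; exact_mod_cast (by omega : d ≠ 0)
    have hr0 : (r : ℝ) ≠ 0 := by have := (mem_Ico.mp hr).1; exact_mod_cast (by omega : r ≠ 0)
    have hφ : (Nat.totient r : ℝ) ≠ 0 := by
      have := (mem_Ico.mp hr).1
      exact_mod_cast (Nat.totient_pos.mpr (by omega)).ne'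
    split_ifs with h
    · push_cast
      field_simp
    · simp
  rw [sum_congr rfl fun d hd => sum_congr rfl fun r hr => hterm d hd r hr, sum_comm]
  simp_rw [← mul_sum]
  -- the inner `d`-sum
  have hinner : ∀ r ∈ Ico 1 N,
      ∑ d ∈ Ico 1 N, (if ((d * r : ℕ) : ℝ) < Z then LamC d else 0) ≤ C₃ * (Z / r) := by
    intro r hr
    have hr1 := (mem_Ico.mp hr).1
    have hr0 : (0 : ℝ) < r := by exact_mod_cast hr1
    rw [← sum_filter]
    have hsub : (Ico 1 N).filter (fun d => ((d * r : ℕ) : ℝ) < Z) ⊆ Icc 1 ⌊Z / r⌋₊ := by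
      intro d hd
      rw [mem_filter, mem_Ico] at hd
      obtain ⟨⟨hd1, -⟩, hdZ⟩ := hd
      rw [mem_Icc]
      refine ⟨hd1, Nat.le_floor ?_⟩
      rw [le_div_iff₀ hr0]
      push_cast at hdZ
      exact hdZ.le
    calc ∑ d ∈ (Ico 1 N).filter (fun d => ((d * r : ℕ) : ℝ) < Z), LamC d
        ≤ ∑ d ∈ Icc 1 ⌊Z / r⌋₊, LamC d :=
          sum_le_sum_of_subset_of_nonneg hsub fun d _ _ => LamC_nonneg d
      _ ≤ C₃ * (⌊Z / r⌋₊ : ℕ) := sum_LamC_le _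
      _ ≤ C₃ * (Z / r) := mul_le_mul_of_nonneg_left (Nat.floor_le (div_nonneg hZ hr0.le)) hC₃0
  have hμ : ∑ r ∈ Ico 1 N, ((ArithmeticFunction.moebius r).natAbs : ℝ) * LamC r /
      ((r : ℝ) * (Nat.totient r : ℝ)) ≤ C₄ :=
    (sum_le_sum_of_subset_of_nonneg hsubN fun r _ _ => by positivity [LamC_nonneg r]).trans
      (sum_moebius_LamC_div_le N)
  calc ∑ r ∈ Ico 1 N, ((ArithmeticFunction.moebius r).natAbs : ℝ) * LamC r / (Nat.totient r : ℝ) /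
          lo * ∑ d ∈ Ico 1 N, (if ((d * r : ℕ) : ℝ) < Z then LamC d else 0)
      ≤ ∑ r ∈ Ico 1 N, ((ArithmeticFunction.moebius r).natAbs : ℝ) * LamC r /
          (Nat.totient r : ℝ) / lo * (C₃ * (Z / r)) :=
        sum_le_sum fun r hr => mul_le_mul_of_nonneg_left (hinner r hr)
          (by positivity [LamC_nonneg r])
    _ = C₃ * Z / lo * ∑ r ∈ Ico 1 N, ((ArithmeticFunction.moebius r).natAbs : ℝ) * LamC r /
          ((r : ℝ) * (Nat.totient r : ℝ)) := by
        rw [mul_sum]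
        refine sum_congr rfl fun r hr => ?_
        have hr0 : (r : ℝ) ≠ 0 := by have := (mem_Ico.mp hr).1; exact_mod_cast (by omega : r ≠ 0)
        field_simp
    _ ≤ C₃ * Z / lo * C₄ := mul_le_mul_of_nonneg_left hμ (by positivity)
    _ = C₃ * C₄ * Z / lo := by ring

/-- `N = ⌈PT⁻²⌉ ≥ 2` and `log N ≤ 2𝓛⁹` once `𝓛 ≥ 3`. [cite: Zhang2022LandauSiegel, §7 (7.2)] -/
theorem two_le_Nsupp_and_log_le {D : ℕ} (hL3 : 3 ≤ ell D) :
    2 ≤ Nsupp D ∧ Real.log (Nsupp D) ≤ 2 * ell D ^ 9 := by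
  set ℓ := ell D with hℓ
  have hℓ1 : 1 ≤ ℓ := by linarith
  have hPT : bigP D / bigT D ^ 2 = Real.exp (ℓ ^ 9 - 2 * ℓ ^ (1.1 : ℝ)) := by
    rw [bigP, bigT, ← Real.exp_nat_mul, ← Real.exp_sub]
    push_cast
    rfl
  have hl11 : ℓ ^ (1.1 : ℝ) ≤ ℓ ^ 2 := by
    calc ℓ ^ (1.1 : ℝ) ≤ ℓ ^ (2 : ℝ) := Real.rpow_le_rpow_of_exponent_le hℓ1 (by norm_num)
      _ = ℓ ^ 2 := Real.rpow_two ℓ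
  have hl9 : 2 * ℓ ^ 2 + 1 ≤ ℓ ^ 9 := by
    have h7 : (2187 : ℝ) ≤ ℓ ^ 7 := by
      calc (2187 : ℝ) = 3 ^ 7 := by norm_num
        _ ≤ ℓ ^ 7 := pow_le_pow_left₀ (by norm_num) hL3 7
    have hl2 : 1 ≤ ℓ ^ 2 := one_le_pow₀ hℓ1
    nlinarith
  have hN2r : (2 : ℝ) ≤ Nsupp D := by
    have h1 : Real.exp 1 ≤ bigP D / bigT D ^ 2 := by
      rw [hPT]; exact Real.exp_le_exp.mpr (by linarith)
    have h2 : (2 : ℝ) ≤ Real.exp 1 := by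
      have := Real.add_one_le_exp (1 : ℝ); linarith
    calc (2 : ℝ) ≤ bigP D / bigT D ^ 2 := h2.trans h1
      _ ≤ Nsupp D := by rw [Nsupp]; exact Nat.le_ceil _
  have hN2 : 2 ≤ Nsupp D := by exact_mod_cast hN2r
  have hNpos : (0 : ℝ) < Nsupp D := by linarith
  have hT1 : 1 ≤ bigT D := by rw [bigT]; exact Real.one_le_exp (by positivity)
  have hNle : (Nsupp D : ℝ) ≤ 2 * bigP D := by
    have hP0 : 0 < bigP D := Real.exp_pos _
    have h1 : (Nsupp D : ℝ) < bigP D / bigT D ^ 2 + 1 := by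
      rw [Nsupp]; exact Nat.ceil_lt_add_one (by positivity)
    have h2 : bigP D / bigT D ^ 2 ≤ bigP D := div_le_self hP0.le (one_le_pow₀ hT1)
    have h3 : 1 ≤ bigP D := by rw [bigP]; exact Real.one_le_exp (by positivity)
    linarith
  refine ⟨hN2, ?_⟩
  calc Real.log (Nsupp D) ≤ Real.log (2 * bigP D) := Real.log_le_log hNpos hNle
    _ = Real.log 2 + ℓ ^ 9 := by
        have hP0 : (bigP D) ≠ 0 := (Real.exp_pos _).ne'
        rw [Real.log_mul (by norm_num) hP0, bigP, Real.log_exp]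
    _ ≤ 1 + ℓ ^ 9 := by
        have := Real.log_le_sub_one_of_pos (show (0:ℝ) < 2 by norm_num); linarith
    _ ≤ 2 * ℓ ^ 9 := by linarith [one_le_pow₀ (n := 9) hℓ1]

/-- **The window bound for `S_j` (the arithmetic half of «by (11.3), (8.25) and (8.26)»).**
There is an absolute `C` such that for every `c′` and all `D ≥ D₀(c′)`: if `‖𝐚₁‖ ≤ B₁`,
`‖𝐚₂‖ ≤ B₂` and both sequences vanish outside the union of the windows `(xη₋, xη₊)`, `x ∈ xs`
(a finite set of centres `0 < x ≤ P`; `η± = e^{±𝓛⁻¹⁰}`), then for every `j`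
`‖S_j(𝐚₁,𝐚₂)‖ ≤ C·(#xs)²·B₁B₂·𝓛⁸`.
Proof: `‖S_j‖ ≤ Σ_{d,r} w(d,r)·B₁H(dr)·B₂(#xs)C_G𝓛⁸` with `w = |μ(r)|Λc(d)Λc(r)/(drφ(r))`
(`norm_weight_le`), `H(dr) = Σ_x[(θ−1) + [dr<xη₊]dr/(xη₋)]` (`norm_msum_window_le`) and the
`n`-window bound `norm_nsum_window_le`; then `(θ−1)Σw ≤ 4𝓛⁻¹⁰·C·2𝓛⁹·C` (`sum_weight_le`) and
`Σ w[dr<xη₊]dr/(xη₋) ≤ C·θ` (`sum_weight_ite_le`). [cite: Zhang2022LandauSiegel, §11 p.64; §7 Prop. 7.1 p.33] -/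
theorem norm_Sj_window_le : ∃ C : ℝ, 0 ≤ C ∧ ∀ c' : ℝ, ∃ D₀ : ℕ, ∀ D : ℕ, D₀ ≤ D →
    ∀ (j : ℕ) (xs : Finset ℝ), (∀ x ∈ xs, 0 < x ∧ x ≤ bigP D) →
    ∀ (B₁ B₂ : ℝ), 0 ≤ B₁ → 0 ≤ B₂ → ∀ a₁ a₂ : ℕ → ℂ,
      (∀ n, ‖a₁ n‖ ≤ B₁) → (∀ n, ‖a₂ n‖ ≤ B₂) →
      (∀ n, a₁ n ≠ 0 → ∃ x ∈ xs, x * etaPM D (-1) < n ∧ (n : ℝ) < x * etaPM D 1) →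
      (∀ n, a₂ n ≠ 0 → ∃ x ∈ xs, x * etaPM D (-1) < n ∧ (n : ℝ) < x * etaPM D 1) →
      ‖Sj c' D j a₁ a₂‖ ≤ C * xs.card ^ 2 * B₁ * B₂ * ell D ^ 8 := by
  obtain ⟨C_G, hC_G, hNs⟩ := norm_nsum_window_le
  set E₂ : ℝ := Real.exp (16 + 7 * LogEulerProduct.tailConst 0) with hE₂
  set C₃ : ℝ := Real.exp (12 + 6 * LogEulerProduct.tailConst 0) with hC₃
  set C₄ : ℝ := Real.exp (14 + 7 * LogEulerProduct.tailConst 0) with hC₄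
  have hE₂0 : 0 ≤ E₂ := (Real.exp_pos _).le
  have hC₃0 : 0 ≤ C₃ := (Real.exp_pos _).le
  have hC₄0 : 0 ≤ C₄ := (Real.exp_pos _).le
  refine ⟨C_G * (8 * E₂ * C₄ + 2 * C₃ * C₄), by positivity, fun c' => ?_⟩
  obtain ⟨D₀, hD₀⟩ := hNs c'
  refine ⟨max D₀ ⌈Real.exp 3⌉₊, fun D hD j xs hxs B₁ B₂ hB₁ hB₂ a₁ a₂ ha₁ ha₂ hs₁ hs₂ => ?_⟩
  have hL3 : 3 ≤ ell D := le_ell_of_ceil_exp_le (le_trans (le_max_right _ _) hD)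
  have hDD₀ : D₀ ≤ D := le_trans (le_max_left _ _) hD
  set ℓ : ℝ := ell D with hℓ
  have hℓ1 : 1 ≤ ℓ := by linarith
  have hℓ0 : 0 < ℓ := by linarith
  obtain ⟨hN2, hlogN⟩ := two_le_Nsupp_and_log_le hL3
  obtain ⟨-, hθhi, hθ1, hθ2⟩ := theta_bounds D (by linarith : 2 ≤ ell D)
  have hθ0 : 0 ≤ Real.exp (2 * (ell D ^ 10)⁻¹) - 1 := by linarith
  set k : ℝ := (xs.card : ℝ) with hk
  -- the window function `H(dr)` and its nonnegativity
  have hH0 : ∀ d r : ℕ, 0 ≤ ∑ x ∈ xs, ((Real.exp (2 * (ell D ^ 10)⁻¹) - 1) +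
      if ((d * r : ℕ) : ℝ) < x * etaPM D 1 then ((d * r : ℕ) : ℝ) / (x * etaPM D (-1)) else 0) := by
    intro d r
    refine sum_nonneg fun x hx => add_nonneg hθ0 ?_
    split_ifs
    · exact div_nonneg (Nat.cast_nonneg _) (mul_pos (hxs x hx).1 (Real.exp_pos _)).le
    · exact le_rfl
  -- termwise bound for the summand of `S_j`
  have hterm : ∀ d ∈ Ico 1 (Nsupp D), ∀ r ∈ Ico 1 (Nsupp D),
      ‖((ArithmeticFunction.moebius r).natAbs : ℂ) * lamZero c' D j (d * r) /
            ((d * r : ℕ) * (Nat.totient r : ℂ)) *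
          (∑ m ∈ Ico 1 (Nsupp D), a₁ (d * r * m) / (m : ℂ) ^ (1 - betaJ c' D j)) *
          (∑ n ∈ Ico 1 (Nsupp D), a₂ (d * r * n) * xiZero c' D j n d r / (n : ℂ))‖ ≤
        ((ArithmeticFunction.moebius r).natAbs : ℝ) * (LamC d * LamC r) /
            (((d * r : ℕ) : ℝ) * (Nat.totient r : ℝ)) *
          (∑ x ∈ xs, ((Real.exp (2 * (ell D ^ 10)⁻¹) - 1) +
            if ((d * r : ℕ) : ℝ) < x * etaPM D 1 then ((d * r : ℕ) : ℝ) / (x * etaPM D (-1)) else 0)) *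
          (B₁ * (B₂ * (k * (C_G * ℓ ^ 8)))) := by
    intro d hd r hr
    have hd0 : d ≠ 0 := by have := (mem_Ico.mp hd).1; omega
    have hr0 : r ≠ 0 := by have := (mem_Ico.mp hr).1; omega
    rw [norm_mul, norm_mul]
    have hw := norm_weight_le c' D hd0 hr0 j
    have hm := norm_msum_window_le c' D (by linarith : 2 ≤ ell D) (Nsupp D) j xs
      (fun x hx => (hxs x hx).1) hB₁ ha₁ hs₁ hd0 hr0
    have hn := hD₀ D hDD₀ (Nsupp D) j xs hxs B₂ hB₂ a₂ ha₂ hs₂ d r hd0 hr0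
    have hw0 : 0 ≤ ((ArithmeticFunction.moebius r).natAbs : ℝ) * (LamC d * LamC r) /
        (((d * r : ℕ) : ℝ) * (Nat.totient r : ℝ)) := by positivity [LamC_nonneg d, LamC_nonneg r]
    calc _ ≤ (((ArithmeticFunction.moebius r).natAbs : ℝ) * (LamC d * LamC r) /
            (((d * r : ℕ) : ℝ) * (Nat.totient r : ℝ))) *
          (B₁ * ∑ x ∈ xs, ((Real.exp (2 * (ell D ^ 10)⁻¹) - 1) +
            if ((d * r : ℕ) : ℝ) < x * etaPM D 1 then ((d * r : ℕ) : ℝ) / (x * etaPM D (-1)) else 0)) *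
          (B₂ * (xs.card * (C_G * ell D ^ 8))) :=
          mul_le_mul (mul_le_mul hw hm (norm_nonneg _) hw0) hn (norm_nonneg _)
            (mul_nonneg hw0 (mul_nonneg hB₁ (hH0 d r)))
      _ = _ := by rw [hk, hℓ]; ring
  -- the per-window weight sums
  have hx_bound : ∀ x ∈ xs,
      ∑ d ∈ Ico 1 (Nsupp D), ∑ r ∈ Ico 1 (Nsupp D),
        ((ArithmeticFunction.moebius r).natAbs : ℝ) * (LamC d * LamC r) /
            (((d * r : ℕ) : ℝ) * (Nat.totient r : ℝ)) *
          (((Real.exp (2 * (ell D ^ 10)⁻¹) - 1) +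
            if ((d * r : ℕ) : ℝ) < x * etaPM D 1 then ((d * r : ℕ) : ℝ) / (x * etaPM D (-1)) else 0)) ≤
        8 * E₂ * C₄ + 2 * C₃ * C₄ := by
    intro x hx
    have hx0 := (hxs x hx).1
    have hlo : 0 < x * etaPM D (-1) := mul_pos hx0 (Real.exp_pos _)
    have hhi : 0 ≤ x * etaPM D 1 := (mul_pos hx0 (Real.exp_pos _)).le
    have hW := sum_weight_le hN2
    have hI := sum_weight_ite_le (Nsupp D) hhi hlo
    have hratio : x * etaPM D 1 / (x * etaPM D (-1)) = Real.exp (2 * (ell D ^ 10)⁻¹) := by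
      rw [etaPM_one_eq_mul D x, mul_div_assoc, div_self hlo.ne', mul_one]
    simp_rw [mul_add, sum_add_distrib, ← sum_mul]
    have h1 : (∑ d ∈ Ico 1 (Nsupp D), ∑ r ∈ Ico 1 (Nsupp D),
        ((ArithmeticFunction.moebius r).natAbs : ℝ) * (LamC d * LamC r) /
          (((d * r : ℕ) : ℝ) * (Nat.totient r : ℝ))) * (Real.exp (2 * (ell D ^ 10)⁻¹) - 1) ≤
        8 * E₂ * C₄ := by
      calc _ ≤ (E₂ * Real.log (Nsupp D) * C₄) * (4 * (ell D ^ 10)⁻¹) :=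
            mul_le_mul hW hθhi hθ0 (by positivity)
        _ ≤ (E₂ * (2 * ℓ ^ 9) * C₄) * (4 * (ell D ^ 10)⁻¹) := by gcongr
        _ = 8 * E₂ * C₄ * ℓ⁻¹ := by rw [hℓ]; field_simp; ring
        _ ≤ 8 * E₂ * C₄ * 1 := by
            refine mul_le_mul_of_nonneg_left (inv_le_one_of_one_le₀ hℓ1) (by positivity)
        _ = 8 * E₂ * C₄ := mul_one _
    have h2 : ∑ d ∈ Ico 1 (Nsupp D), ∑ r ∈ Ico 1 (Nsupp D),
        ((ArithmeticFunction.moebius r).natAbs : ℝ) * (LamC d * LamC r) /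
            (((d * r : ℕ) : ℝ) * (Nat.totient r : ℝ)) *
          (if ((d * r : ℕ) : ℝ) < x * etaPM D 1 then ((d * r : ℕ) : ℝ) / (x * etaPM D (-1)) else 0) ≤
        2 * C₃ * C₄ := by
      calc _ ≤ C₃ * C₄ * (x * etaPM D 1) / (x * etaPM D (-1)) := hI
        _ = C₃ * C₄ * Real.exp (2 * (ell D ^ 10)⁻¹) := by rw [mul_div_assoc, hratio]
        _ ≤ C₃ * C₄ * 2 := mul_le_mul_of_nonneg_left hθ2 (by positivity)
        _ = 2 * C₃ * C₄ := by ring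
    linarith
  -- the double sum of `w·H`
  have hmain : ∑ d ∈ Ico 1 (Nsupp D), ∑ r ∈ Ico 1 (Nsupp D),
      ((ArithmeticFunction.moebius r).natAbs : ℝ) * (LamC d * LamC r) /
          (((d * r : ℕ) : ℝ) * (Nat.totient r : ℝ)) *
        (∑ x ∈ xs, ((Real.exp (2 * (ell D ^ 10)⁻¹) - 1) +
          if ((d * r : ℕ) : ℝ) < x * etaPM D 1 then ((d * r : ℕ) : ℝ) / (x * etaPM D (-1)) else 0)) ≤
      k * (8 * E₂ * C₄ + 2 * C₃ * C₄) := by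
    calc _ = ∑ d ∈ Ico 1 (Nsupp D), ∑ r ∈ Ico 1 (Nsupp D), ∑ x ∈ xs,
          ((ArithmeticFunction.moebius r).natAbs : ℝ) * (LamC d * LamC r) /
              (((d * r : ℕ) : ℝ) * (Nat.totient r : ℝ)) *
            (((Real.exp (2 * (ell D ^ 10)⁻¹) - 1) +
              if ((d * r : ℕ) : ℝ) < x * etaPM D 1 then ((d * r : ℕ) : ℝ) / (x * etaPM D (-1))
              else 0)) := by
          simp_rw [mul_sum]
      _ = ∑ d ∈ Ico 1 (Nsupp D), ∑ x ∈ xs, ∑ r ∈ Ico 1 (Nsupp D),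
          ((ArithmeticFunction.moebius r).natAbs : ℝ) * (LamC d * LamC r) /
              (((d * r : ℕ) : ℝ) * (Nat.totient r : ℝ)) *
            (((Real.exp (2 * (ell D ^ 10)⁻¹) - 1) +
              if ((d * r : ℕ) : ℝ) < x * etaPM D 1 then ((d * r : ℕ) : ℝ) / (x * etaPM D (-1))
              else 0)) := sum_congr rfl fun d _ => sum_comm
      _ = ∑ x ∈ xs, ∑ d ∈ Ico 1 (Nsupp D), ∑ r ∈ Ico 1 (Nsupp D),
          ((ArithmeticFunction.moebius r).natAbs : ℝ) * (LamC d * LamC r) /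
              (((d * r : ℕ) : ℝ) * (Nat.totient r : ℝ)) *
            (((Real.exp (2 * (ell D ^ 10)⁻¹) - 1) +
              if ((d * r : ℕ) : ℝ) < x * etaPM D 1 then ((d * r : ℕ) : ℝ) / (x * etaPM D (-1))
              else 0)) := sum_comm
      _ ≤ ∑ x ∈ xs, (8 * E₂ * C₄ + 2 * C₃ * C₄) := sum_le_sum hx_bound
      _ = k * (8 * E₂ * C₄ + 2 * C₃ * C₄) := by rw [sum_const, nsmul_eq_mul]
  -- assemble
  have hfac0 : 0 ≤ B₁ * (B₂ * (k * (C_G * ℓ ^ 8))) := by positivity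
  rw [Skeleton.Sj]
  calc _ ≤ ∑ d ∈ Ico 1 (Nsupp D), ‖∑ r ∈ Ico 1 (Nsupp D),
          ((ArithmeticFunction.moebius r).natAbs : ℂ) * lamZero c' D j (d * r) /
              ((d * r : ℕ) * (Nat.totient r : ℂ)) *
            (∑ m ∈ Ico 1 (Nsupp D), a₁ (d * r * m) / (m : ℂ) ^ (1 - betaJ c' D j)) *
            (∑ n ∈ Ico 1 (Nsupp D), a₂ (d * r * n) * xiZero c' D j n d r / (n : ℂ))‖ :=
        norm_sum_le _ _
    _ ≤ ∑ d ∈ Ico 1 (Nsupp D), ∑ r ∈ Ico 1 (Nsupp D),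
          ‖((ArithmeticFunction.moebius r).natAbs : ℂ) * lamZero c' D j (d * r) /
              ((d * r : ℕ) * (Nat.totient r : ℂ)) *
            (∑ m ∈ Ico 1 (Nsupp D), a₁ (d * r * m) / (m : ℂ) ^ (1 - betaJ c' D j)) *
            (∑ n ∈ Ico 1 (Nsupp D), a₂ (d * r * n) * xiZero c' D j n d r / (n : ℂ))‖ :=
        sum_le_sum fun d _ => norm_sum_le _ _
    _ ≤ ∑ d ∈ Ico 1 (Nsupp D), ∑ r ∈ Ico 1 (Nsupp D),
          ((ArithmeticFunction.moebius r).natAbs : ℝ) * (LamC d * LamC r) /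
              (((d * r : ℕ) : ℝ) * (Nat.totient r : ℝ)) *
            (∑ x ∈ xs, ((Real.exp (2 * (ell D ^ 10)⁻¹) - 1) +
              if ((d * r : ℕ) : ℝ) < x * etaPM D 1 then ((d * r : ℕ) : ℝ) / (x * etaPM D (-1))
              else 0)) *
            (B₁ * (B₂ * (k * (C_G * ℓ ^ 8)))) :=
        sum_le_sum fun d hd => sum_le_sum fun r hr => hterm d hd r hr
    _ = (∑ d ∈ Ico 1 (Nsupp D), ∑ r ∈ Ico 1 (Nsupp D),
          ((ArithmeticFunction.moebius r).natAbs : ℝ) * (LamC d * LamC r) /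
              (((d * r : ℕ) : ℝ) * (Nat.totient r : ℝ)) *
            (∑ x ∈ xs, ((Real.exp (2 * (ell D ^ 10)⁻¹) - 1) +
              if ((d * r : ℕ) : ℝ) < x * etaPM D 1 then ((d * r : ℕ) : ℝ) / (x * etaPM D (-1))
              else 0))) *
          (B₁ * (B₂ * (k * (C_G * ℓ ^ 8)))) := by
        rw [sum_mul]
        refine sum_congr rfl fun d _ => ?_
        rw [sum_mul]
    _ ≤ (k * (8 * E₂ * C₄ + 2 * C₃ * C₄)) * (B₁ * (B₂ * (k * (C_G * ℓ ^ 8)))) :=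
        mul_le_mul_of_nonneg_right hmain hfac0
    _ = C_G * (8 * E₂ * C₄ + 2 * C₃ * C₄) * xs.card ^ 2 * B₁ * B₂ * ell D ^ 8 := by
        rw [hk, hℓ]; ring

end Literature.NumberTheory.LFunctions.Zhang2022.WindowSj
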